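import Mathlib
import Literature.NumberTheory.EllipticCurves.ModularCurve
import Literature.NumberTheory.Automorphic.BrandtXi

/-!
# Sketch — crux-ideate stmt-ABC-2157 (TorsionSharingPrimeBound), ideator k=1, round 1

First lemmas of the two crux idea cards (they only need to ELABORATE; proofs are not claimed):

* Card 1 `adjoint-selmer-division-field`: `Card1FirstLemma` — the Ribet–Wiles difference cocycle of
  two lifts `G → GL₂(ℤ/ℓ^{k+1})` congruent mod `ℓ^k` is an `Ad ρ̄`-valued 1-cocycle, traceless when
  the determinants agree, and a coboundary iff the lifts are conjugate by a matrix `≡ 1 (mod ℓ^k)`.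
* Card 2 `supercuspidal-companion-multiplicity`: `Card2FirstLemma` — a Jordan block mod `ℓ` at an
  integral eigen-line of `w`-self-adjoint integer matrices forces `ℓ ∣ ξ = Σ w_i φ_i²`;
  `Card2TransferTrivialWeight` — the statable (trivial-weight) shadow of the transfer target C⁺ over
  the tree's `Brandt.XiSetup N ℓ`.
-/

namespace Summit.ABC.ABC.Cruxes.TorsionSharingPrimeBound.Sketch

open Matrix

section Card1

variable {G : Type*} [Group G]

/-- Reduction `ℤ/ℓ^(k+1) → ℤ/ℓ`. -/
noncomputable def redTop (ℓ k : ℕ) : ZMod (ℓ ^ (k + 1)) →+* ZMod ℓ :=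
  ZMod.castHom (dvd_pow_self ℓ (Nat.succ_ne_zero k)) (ZMod ℓ)

/-- Reduction `ℤ/ℓ^(k+1) → ℤ/ℓ^k`. -/
noncomputable def redMid (ℓ k : ℕ) : ZMod (ℓ ^ (k + 1)) →+* ZMod (ℓ ^ k) :=
  ZMod.castHom (pow_dvd_pow ℓ (Nat.le_succ k)) (ZMod (ℓ ^ k))

/-- Divided difference: for `x ≡ 0 (mod ℓ^k)` in `ℤ/ℓ^(k+1)`, the class of `x / ℓ^k` in `ℤ/ℓ`. -/
def divPow (ℓ k : ℕ) (x : ZMod (ℓ ^ (k + 1))) : ZMod ℓ :=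
  ((x.val / ℓ ^ k : ℕ) : ZMod ℓ)

/-- The residual representation `ρ̄ = ρ mod ℓ`, as matrices. -/
noncomputable def rbar (ℓ k : ℕ) (ρ : G →* GL (Fin 2) (ZMod (ℓ ^ (k + 1)))) (g : G) :
    Matrix (Fin 2) (Fin 2) (ZMod ℓ) :=
  ((ρ g : GL (Fin 2) (ZMod (ℓ ^ (k + 1)))) : Matrix (Fin 2) (Fin 2) (ZMod (ℓ ^ (k + 1)))).map
    (redTop ℓ k)

/-- The Ribet–Wiles difference cocycle `g ↦ (ρ₂(g) ρ₁(g)⁻¹ − 1)/ℓ^k mod ℓ`. -/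
noncomputable def diffCocycle (ℓ k : ℕ) (ρ₁ ρ₂ : G →* GL (Fin 2) (ZMod (ℓ ^ (k + 1)))) (g : G) :
    Matrix (Fin 2) (Fin 2) (ZMod ℓ) :=
  (((ρ₂ g : GL (Fin 2) (ZMod (ℓ ^ (k + 1)))) : Matrix (Fin 2) (Fin 2) (ZMod (ℓ ^ (k + 1)))) *
      (((ρ₁ g)⁻¹ : GL (Fin 2) (ZMod (ℓ ^ (k + 1)))) : Matrix (Fin 2) (Fin 2) (ZMod (ℓ ^ (k + 1))))
      - 1).map (divPow ℓ k)

/-- The two lifts agree modulo `ℓ^k`. -/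
def CongruentModPow (ℓ k : ℕ) (ρ₁ ρ₂ : G →* GL (Fin 2) (ZMod (ℓ ^ (k + 1)))) : Prop :=
  ∀ g : G,
    ((ρ₁ g : GL (Fin 2) (ZMod (ℓ ^ (k + 1)))) : Matrix (Fin 2) (Fin 2) (ZMod (ℓ ^ (k + 1)))).map
        (redMid ℓ k) =
      ((ρ₂ g : GL (Fin 2) (ZMod (ℓ ^ (k + 1)))) : Matrix (Fin 2) (Fin 2) (ZMod (ℓ ^ (k + 1)))).map
        (redMid ℓ k)

/-- **First lemma of card 1** (Ribet 1976; Wiles 1995, "(c) ⇒ (a)"): for two lifts congruent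
mod `ℓ^k`, (i) `diffCocycle` is a 1-cocycle for the adjoint action of `ρ̄₁`; (ii) it is traceless
(`Ad⁰`-valued) when the determinants agree; (iii) it is a coboundary iff the lifts are conjugate by
some `P ≡ 1 (mod ℓ^k)`.  Applied to `ρ₁ = ρ_{E,ℓ} mod ℓ^{k+1}` and `ρ₂ = ρ_{g,λ} mod λ^{k+1}`
(degree-one prime `λ`, congruence of exact depth `k`) it yields the nonzero class in
`H¹(ℚ, Ad⁰ E[ℓ])` whose local conditions (flat at `ℓ`, minimal at `p ∣ N`) are the card's K1. -/
def Card1FirstLemma : Prop :=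
  ∀ (G : Type) [Group G] (ℓ k : ℕ) [Fact ℓ.Prime], 0 < k →
    ∀ ρ₁ ρ₂ : G →* GL (Fin 2) (ZMod (ℓ ^ (k + 1))), CongruentModPow ℓ k ρ₁ ρ₂ →
      (∀ g h : G, diffCocycle ℓ k ρ₁ ρ₂ (g * h) =
          diffCocycle ℓ k ρ₁ ρ₂ g + rbar ℓ k ρ₁ g * diffCocycle ℓ k ρ₁ ρ₂ h * (rbar ℓ k ρ₁ g)⁻¹) ∧
      ((∀ g : G,
          Matrix.det (((ρ₁ g : GL (Fin 2) (ZMod (ℓ ^ (k + 1)))) :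
              Matrix (Fin 2) (Fin 2) (ZMod (ℓ ^ (k + 1))))) =
            Matrix.det (((ρ₂ g : GL (Fin 2) (ZMod (ℓ ^ (k + 1)))) :
              Matrix (Fin 2) (Fin 2) (ZMod (ℓ ^ (k + 1)))))) →
        ∀ g : G, Matrix.trace (diffCocycle ℓ k ρ₁ ρ₂ g) = 0) ∧
      ((∃ b : Matrix (Fin 2) (Fin 2) (ZMod ℓ), ∀ g : G,
          diffCocycle ℓ k ρ₁ ρ₂ g = b - rbar ℓ k ρ₁ g * b * (rbar ℓ k ρ₁ g)⁻¹) ↔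
        ∃ P : GL (Fin 2) (ZMod (ℓ ^ (k + 1))),
          ((P : Matrix (Fin 2) (Fin 2) (ZMod (ℓ ^ (k + 1)))).map (redMid ℓ k) = 1 ∧
            ∀ g : G, ρ₂ g = P * ρ₁ g * P⁻¹))

end Card1

section Card2

open Literature.NumberTheory.Automorphic

/-- **First lemma of card 2** (abstract Brandt layer of `BrandtXi.lean`): if the `T p` (`p ∤ N`
prime) are self-adjoint for `⟨u, v⟩ = Σ w_i u_i v_i`, `φ` is an integral common eigenvector for the
system `λ`, and `ψ` is a GENERALISED eigenvector mod `ℓ` sitting over `φ` — `(T p − λ p) ψ ≡ c_p φ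
(mod ℓ)` with some `c_p ≢ 0 (mod ℓ)` (a Jordan block) — then `ℓ ∣ ξ(φ) = Σ w_i φ_i²`.  Proof:
`0 = ⟨φ, (T p − λ p)ψ⟩ ≡ c_p ξ (mod ℓ)`.  This is the mechanism by which a non-reduced `T_𝔪/ℓ`
forces isotropy of the eigen-line (q-adic and char-ℓ avatars alike); the converse needs the
module to be free of rank one over `T_𝔪` (Gorenstein / multiplicity one), which is NOT part of this
lemma (counterexample `T = diag(λ, λ + ℓ m)` otherwise). -/
def Card2FirstLemma : Prop :=
  ∀ (ι : Type) [Fintype ι] [DecidableEq ι] (N ℓ : ℕ), ℓ.Prime →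
    ∀ (T : ℕ → Matrix ι ι ℤ) (w : ι → ℕ) (lam : ℕ → ℤ) (φ ψ : ι → ℤ) (c : ℕ → ℤ),
      (∀ p : ℕ, p.Prime → ¬ p ∣ N → ∀ i j : ι, (w i : ℤ) * T p i j = (w j : ℤ) * T p j i) →
      φ ∈ Brandt.eigenLattice N T lam →
      (∀ p : ℕ, p.Prime → ¬ p ∣ N →
          ∃ r : ι → ℤ, (T p) *ᵥ ψ - lam p • ψ = c p • φ + (ℓ : ℤ) • r) →
      (∃ p : ℕ, p.Prime ∧ ¬ p ∣ N ∧ ¬ ((ℓ : ℤ) ∣ c p)) →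
      (ℓ : ℤ) ∣ ∑ i, (w i : ℤ) * φ i ^ 2

/-- **Transfer target of card 2, trivial-weight shadow** (statable over the tree now; the full
target needs the `ω₂`-isotypic Brandt module of `B_{ℓ,∞}` at level `N`, definition request D1):
for `ℓ > C N^κ` prime, `ℓ ∤ N`, and every Brandt setup of level `(N, ℓ)` (definite quaternion
algebra of discriminant `ℓ`, Eichler order of level `N`), the eigensystem `(a_p(W) mod ℓ)_{p ∤ Nℓ}`
has NO Jordan block in the Brandt module mod `ℓ`: `M[𝔪̄²] = M[𝔪̄]`. -/
def Card2TransferTrivialWeight : Prop :=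
  ∃ κ C : ℝ, 0 ≤ κ ∧ ∀ (W : WeierstrassCurve ℚ) [W.IsElliptic] [W.IsGloballyMinimal]
    [NeZero (W.conductorNorm ℤ)], W.IsSemistable ℤ →
    ∀ ℓ : ℕ, ℓ.Prime → ¬ (ℓ ∣ W.conductorNorm ℤ) →
      C * ((W.conductorNorm ℤ : ℕ) : ℝ) ^ κ < ℓ →
      ∀ (S : Brandt.XiSetup (W.conductorNorm ℤ) ℓ) [Fintype (Brandt.ClassSet S.O)]
        [DecidableEq (Brandt.ClassSet S.O)]
        (ψ : Brandt.ClassSet S.O → ZMod ℓ),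
        (∀ p q : ℕ, p.Prime → q.Prime → ¬ p ∣ W.conductorNorm ℤ * ℓ → ¬ q ∣ W.conductorNorm ℤ * ℓ →
          ((Brandt.matrix S.O p).map (Int.cast : ℤ → ZMod ℓ) - ((W.LFunction p : ℤ) : ZMod ℓ) • 1) *ᵥ
            (((Brandt.matrix S.O q).map (Int.cast : ℤ → ZMod ℓ) - ((W.LFunction q : ℤ) : ZMod ℓ) • 1)
              *ᵥ ψ) = 0) →
        ∀ p : ℕ, p.Prime → ¬ p ∣ W.conductorNorm ℤ * ℓ →
          ((Brandt.matrix S.O p).map (Int.cast : ℤ → ZMod ℓ) - ((W.LFunction p : ℤ) : ZMod ℓ) • 1)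
            *ᵥ ψ = 0

end Card2

/-! (The folder copy `Sketch.lean` additionally imports the route file and checks that
`Summit.ABC.ABC.Theses.IsogenyGlueCongruence.TorsionSharingPrimeBound` is in scope; dropped here so the
workfile elaborates independently of route-file revisions.) -/

end Summit.ABC.ABC.Cruxes.TorsionSharingPrimeBound.Sketch
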